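import Literature.MathematicalPhysics.QuantumFieldTheory.BalabanImbrieJaffe1984to88.BIJ88BlockGauge417

/-!
# `BalabanImbrieJaffe1984to88.BIJ88GaugeAverage` — T. Bałaban, J. Imbrie, A. Jaffe, *Effective action and cluster properties of the
abelian Higgs model*, Commun. Math. Phys. **114** (1988) 257–315 [BalabanImbrieJaffe1988], (4.17) p. 277 *"block field gauge invariance"*
of the renormalized densities and (3.11) p. 266: the GAUGE AVERAGE over the compact gauge group `T₁^{(j)} → U(1)` of a level — the
exactly gauge-invariant VERSION of a density that is gauge invariant almost everywhere — and the insensitivity of the typed (3.11)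
(`BIJ88RenormTransf311.IsRT311`) to a change of `ρ₁^L` on a null set.  File 1/2 of seat p34 gen 4; file 2/2 `BIJ88RTIterated` ITERATES
the renormalization transformation (3.11) = [BalabanImbrieJaffe1985] (3.3) `k` times with these tools.

statement-level skeleton of published theorems with citation tags; proofs where landed; nothing here is a claim about the Yang–Mills mass gap

PDF held: `paper:balaban1988-cmp114-bij-abelian-higgs-effective-action` (journal page = PDF page + 256), pp. 266–267 [PDF 10–11],
274 [PDF 18], 277–278 [PDF 21–22] read this session (`lit read … --pages 18-22`, OCR; r18's render
`HOME/lit-balaban-r18/renders/c2/c2-p010b.png`); T. Bałaban, J. Imbrie, A. Jaffe, *Renormalization of the Higgs model: minimizers,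
propagators and the stability of mean field theory*, Commun. Math. Phys. **97** (1985) 299–329 [BalabanImbrieJaffe1985]
(`paper:balaban1985-cmp97-bij-higgs-minimizers`, journal page = PDF page + 298), pp. 303, 306 [PDF 5, 8].

CITATION HEADER (lean-in-tree rule).  Part of the lit-balaban TYPED SKELETON (HOME `run/shared/lean/pub/lit-balaban/`), PHASE-2
proof seat p34 gen 4 (unit `lit-balaban-p34-g4`; TAKING line HOME/STATUS.md 2026-08-21T05:13Z, typed-row protocol, own lineage =
the C1/C2 renormalization-transformation line of seat p34: `BIJ85RT33` (3.3), `BIJ85RT37Normalization` (3.7), `BIJ88RT311Exists`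
(3.11)-existence).  Rows served (fold owners r18 = C2 §§1–4, r15 = C1): `C2.Eq4.17` += exactly invariant versions of the renormalized
densities, `C2.Eq3.11` += a.e.-congruence; it is r18 gen 4's hand-off item *"multi-step block gauge invariance"*
(HOME/lit-balaban-r18/HANDOFF.md).

THE PRINTED TEXT.  [BalabanImbrieJaffe1988] p. 277 [PDF 21], (4.17): *"The second kind of gauge invariance is called block field gauge
invariance, and is invariance under u_b → u_be^{−ie_k(∂λ)(b)}, φ(x) → e^{ie_kλ(x)}[φ] … for λ a function on T₁^{(k)}. … and thus we have
invariance in the previous sense. … since the measure dφ^{(j)} is rotationally invariant, no account need be made of these rotations"*;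
p. 274 [PDF 18]: *"The measure du^{(j)} is the normalized measure on U(1), ∫du^{(j)} = 1"*; p. 278 [PDF 22]: *"Under gauge transformations
λ of u, φ, u^{(j)} … we see that the δ-functions and ρ′_k are invariant. … Thus no change is made if we insert the axial gauge conditions
… (5.1.4)"*.  [BalabanImbrieJaffe1985] p. 303 [PDF 5], (2.7): *"let h denote a map from the unit lattice to U(1). Then h defines the
gauge transformation φ_y → h(y)φ_y ≡ φ^h_y, u_{yy′} → h(y)u_{yy′}h(y′)^{−1} ≡ u^h_{yy′}"*; p. 306 [PDF 8]: *"These gauge transformations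
preserve the axial gauge … They generate the gauge group of the integral 𝒯(exp −S)."*

WHY THIS FILE EXISTS (reading device, declared).  In the tree the renormalized density `ρ₁^L = 𝒯ρ₀` of (3.11) is a Radon–Nikodym
density (p34 gen 2's `BIJ85RT33.RTData.rt`), defined `dv dψ`-almost everywhere, and r18 gen 4's (4.17) `BIJ88BlockGauge417.rt_blockGauge_ae_eq`
is correspondingly an almost-everywhere statement for each single gauge transformation `g`.  The NEXT renormalization step, however,
needs an integrand that is gauge invariant ON THE NOSE: its axial gauge fix `∫𝒟u δ_{Ax}(u)(·)` (`BIJ88RenormTransf311.integral_axialMeasure_eq`,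
the unit Faddeev–Popov factor behind (5.1.4) *"no change is made"*) integrates over a `𝒟u`-NULL set, to which an almost-everywhere
identity does not transfer.  Averaging over the compact gauge group produces the canonical exactly invariant version and changes the
density only on a null set, so every typed statement about `ρ₁^L` ((3.11), (3.13)) is unaffected.
WHAT IS PROVED HERE (torus carrier of record `Balaban1983to89.Setup`; `U(1)` = `BIJ88Sect3Statements.U1`; `𝒟u` = `fieldMeasure`, `𝒟φ` =
Lebesgue measure on `ℂ^{T}`).  §1 The gauge group `T₁^{(j)} → G` as a probability space (`transfMeasure`, product of the normalized Haar
measures; right invariance `measurePreserving_mul_right`, `integral_comp_mul_right`); the joint action (2.7) `(u, φ) ↦ (u^g, gφ)` (`act`) is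
jointly measurable in `(g, u, φ)` (`measurable_act`), preserves `𝒟u𝒟φ` for each `g` (`measurePreserving_act`: r18's `measurePreserving_gaugeAct`
× p34's `measurePreserving_twist`) and its skew product preserves `dg ⊗ 𝒟u𝒟φ` (`measurePreserving_skew`); the GAUGE AVERAGE
`gaugeAvg ρ (u, φ) := ∫dg ρ(u^g, gφ)` is EXACTLY jointly gauge invariant with no hypothesis on `ρ` (`jointInvariant_gaugeAvg`), the identity
on invariant densities (`gaugeAvg_eq_self`), jointly measurable (`measurable_gaugeAvg`), integrable with `ρ` (`integrable_gaugeAvg`), and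
EQUAL TO `ρ` ALMOST EVERYWHERE whenever `ρ` is a.e.-invariant under every single `g` (`gaugeAvg_ae_eq`, Fubini–Tonelli).  §2 (3.11) sees
`ρ₁^L` only through `dv dψ`-integrals: `IsRT311 Qu Qφ a ρ₀ ρ₁`, `ρ₁' = ρ₁` a.e. (both integrable) ⇒ `IsRT311 Qu Qφ a ρ₀ ρ₁'`
(`isRT311_congr_ae`, companion of r18's `isRT311_unique`); the Radon–Nikodym transform `𝒯ρ` is jointly measurable (`measurable_rt`).
NOT DONE HERE: the iteration itself (file 2/2 `BIJ88RTIterated`).  Uses BY NAME r18's `measurePreserving_gaugeAct`, the cell's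
`T4AvgDerivBound.gaugeAct_gaugeAct`, p34 gen 2's `measurePreserving_twist`/`twist`; re-declares nothing; imports Literature + Mathlib only;
no `Prop`-valued fact is introduced; standard axioms.
-/

namespace Literature.MathematicalPhysics.QuantumFieldTheory.BalabanImbrieJaffe1984to88.BIJ88GaugeAverage

open Literature.MathematicalPhysics.QuantumFieldTheory.Balaban1983to89
open BIJ88Sect3Statements (U1 toC toC_mul toC_one toC_inv norm_toC bracket actionU1)
open BIJ85Sect1Model (HiggsField)
open BIJ85RT33 (JointInvariant twist twist_apply measurable_twist measurable_toC measurePreserving_twist gaugeInvariant_integral)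
open BIJ88RenormTransf311 (IsRT311)
open BIJ88BlockGauge417 (measurePreserving_gaugeAct)
open GaugeField (gaugeAct GaugeInvariant)
open scoped BigOperators ENNReal
open _root_.MeasureTheory _root_.MeasureTheory.Measure Complex Function

noncomputable section

variable {P : Params} {j : ℕ}

/-! ## §1 The gauge group of a level as a probability space; the gauge average of a density -/

/-- kernel (plumbing): product measurable structure on gauge transformations `T₁^{(j)} → G`. [folklore] -/
instance instMeasurableSpaceGaugeTransf {G : Type*} [MeasurableSpace G] : MeasurableSpace (GaugeTransf P j G) :=
  inferInstanceAs (MeasurableSpace (Balaban1983to89.Site P j → G))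

/-- The gauge group `{g : T₁^{(j)} → U(1)}` of p. 277 (*"for λ a function on T₁^{(k)}"*, `g = e^{ie_kλ}`) as a probability space: the
product over the sites of the normalized Haar measures `dg(x)` (p. 274: *"the normalized measure on U(1)"*).
[cite: BalabanImbrieJaffe1988, (4.17) p.277] -/
def transfMeasure (P : Params) (j : ℕ) (G : Type*) [GaugeGroup G] [MeasurableSpace G] [HaarData G] : Measure (GaugeTransf P j G) :=
  Measure.pi fun _ : Balaban1983to89.Site P j => (HaarData.haar : Measure G)

/-- kernel: `∫dg = 1`. [cite: BalabanImbrieJaffe1988, (4.17) p.277] -/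
instance isProbabilityMeasure_transfMeasure {G : Type*} [GaugeGroup G] [MeasurableSpace G] [HaarData G] :
    IsProbabilityMeasure (transfMeasure P j G) := by
  haveI : ∀ _ : Balaban1983to89.Site P j, IsProbabilityMeasure (HaarData.haar : Measure G) := fun _ => HaarData.isProb
  unfold transfMeasure
  exact Measure.pi.instIsProbabilityMeasure _

/-- kernel: right multiplication `g ↦ gh` in the gauge group preserves `dg` (right invariance of Haar measure, sitewise).
[cite: BalabanImbrieJaffe1988, (4.17) p.277] -/
theorem measurePreserving_mul_right {G : Type*} [GaugeGroup G] [MeasurableSpace G] [HaarData G] [MeasurableMul G]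
    (h : GaugeTransf P j G) :
    MeasurePreserving (fun (g : GaugeTransf P j G) (x : Balaban1983to89.Site P j) => g x * h x)
      (transfMeasure P j G) (transfMeasure P j G) := by
  unfold transfMeasure
  exact measurePreserving_pi (fun _ : Balaban1983to89.Site P j => (HaarData.haar : Measure G)) (fun _ => HaarData.haar)
    (f := fun x g => g * h x) (fun x => ⟨measurable_mul_const (h x), HaarData.map_mul_right (h x)⟩)

/-- kernel: `∫dg F(gh) = ∫dg F(g)` for every integrand (no measurability needed: a measurable equivalence).
[cite: BalabanImbrieJaffe1988, (4.17) p.277] -/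
theorem integral_comp_mul_right {G : Type*} [GaugeGroup G] [MeasurableSpace G] [HaarData G] [MeasurableMul G]
    {E : Type*} [NormedAddCommGroup E] [NormedSpace ℝ E] (h : GaugeTransf P j G) (F : GaugeTransf P j G → E) :
    ∫ g, F (fun x => g x * h x) ∂transfMeasure P j G = ∫ g, F g ∂transfMeasure P j G := by
  let e : GaugeTransf P j G ≃ᵐ GaugeTransf P j G :=
    MeasurableEquiv.piCongrRight fun x : Balaban1983to89.Site P j => MeasurableEquiv.mulRight (h x)
  have he : (e : GaugeTransf P j G → GaugeTransf P j G) = fun g x => g x * h x := by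
    funext g x
    rfl
  have hmp : MeasurePreserving e (transfMeasure P j G) (transfMeasure P j G) := by
    rw [he]
    exact measurePreserving_mul_right h
  have hF := hmp.integral_comp' F
  rw [he] at hF
  exact hF

/-- kernel: composing two gauge transformations (2.7) on the scalar field, `g(hφ) = (gh)φ` (the gauge-field half is the cell's
`T4AvgDerivBound.gaugeAct_gaugeAct`). [cite: BalabanImbrieJaffe1985, (2.7) p.303] -/
theorem twist_twist (g h : GaugeTransf P j U1) (φ : HiggsField P j) :
    twist g (twist h φ) = twist (fun x => g x * h x) φ := by
  funext x
  simp only [twist_apply, toC_mul, mul_assoc]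

/-- The joint gauge action (2.7) on `(u, φ)`: `(u, φ) ↦ (u^g, gφ)`. [cite: BalabanImbrieJaffe1985, (2.7) p.303] -/
def act (g : GaugeTransf P j U1) (z : GaugeField P j U1 × HiggsField P j) : GaugeField P j U1 × HiggsField P j :=
  (gaugeAct g z.1, twist g z.2)

/-- kernel: the joint action is JOINTLY measurable in the group element and the configuration (`U(1)` is a measurable group).
[cite: BalabanImbrieJaffe1985, (2.7) p.303] -/
theorem measurable_act :
    Measurable fun p : GaugeTransf P j U1 × (GaugeField P j U1 × HiggsField P j) => act p.1 p.2 := by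
  change Measurable fun p : GaugeTransf P j U1 × (GaugeField P j U1 × HiggsField P j) => (gaugeAct p.1 p.2.1, twist p.1 p.2.2)
  refine Measurable.prodMk ?_ ?_
  · refine measurable_pi_lambda _ fun b => ?_
    have h1 : Measurable fun p : GaugeTransf P j U1 × (GaugeField P j U1 × HiggsField P j) => p.1 b.src :=
      (measurable_pi_apply b.src).comp measurable_fst
    have h2 : Measurable fun p : GaugeTransf P j U1 × (GaugeField P j U1 × HiggsField P j) => p.2.1 b :=
      (measurable_pi_apply b).comp (measurable_fst.comp measurable_snd)
    have h3 : Measurable fun p : GaugeTransf P j U1 × (GaugeField P j U1 × HiggsField P j) => (p.1 b.tgt)⁻¹ :=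
      ((measurable_pi_apply b.tgt).comp measurable_fst).inv
    exact (h1.mul h2).mul h3
  · refine measurable_pi_lambda _ fun x => ?_
    have h1 : Measurable fun p : GaugeTransf P j U1 × (GaugeField P j U1 × HiggsField P j) => toC (p.1 x) :=
      measurable_toC.comp ((measurable_pi_apply x).comp measurable_fst)
    have h2 : Measurable fun p : GaugeTransf P j U1 × (GaugeField P j U1 × HiggsField P j) => p.2.2 x :=
      (measurable_pi_apply x).comp (measurable_snd.comp measurable_snd)
    exact h1.mul h2

/-- kernel: the same with the factors in the order `((u, φ), g)` (proved directly: composing `measurable_act` with `Prod.swap`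
is needlessly expensive to elaborate). [cite: BalabanImbrieJaffe1985, (2.7) p.303] -/
theorem measurable_act_swap :
    Measurable fun q : (GaugeField P j U1 × HiggsField P j) × GaugeTransf P j U1 => act q.2 q.1 := by
  change Measurable fun q : (GaugeField P j U1 × HiggsField P j) × GaugeTransf P j U1 => (gaugeAct q.2 q.1.1, twist q.2 q.1.2)
  refine Measurable.prodMk ?_ ?_
  · refine measurable_pi_lambda _ fun b => ?_
    have h1 : Measurable fun p : (GaugeField P j U1 × HiggsField P j) × GaugeTransf P j U1 => p.2 b.src :=
      (measurable_pi_apply b.src).comp measurable_snd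
    have h2 : Measurable fun p : (GaugeField P j U1 × HiggsField P j) × GaugeTransf P j U1 => p.1.1 b :=
      (measurable_pi_apply b).comp (measurable_fst.comp measurable_fst)
    have h3 : Measurable fun p : (GaugeField P j U1 × HiggsField P j) × GaugeTransf P j U1 => (p.2 b.tgt)⁻¹ :=
      ((measurable_pi_apply b.tgt).comp measurable_snd).inv
    exact (h1.mul h2).mul h3
  · refine measurable_pi_lambda _ fun x => ?_
    have h1 : Measurable fun p : (GaugeField P j U1 × HiggsField P j) × GaugeTransf P j U1 => toC (p.2 x) :=
      measurable_toC.comp ((measurable_pi_apply x).comp measurable_snd)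
    have h2 : Measurable fun p : (GaugeField P j U1 × HiggsField P j) × GaugeTransf P j U1 => p.1.2 x :=
      (measurable_pi_apply x).comp (measurable_snd.comp measurable_fst)
    exact h1.mul h2

/-- kernel: for a fixed `g` the joint action preserves `𝒟u𝒟φ` (`𝒟u` gauge invariant, `𝒟φ` rotation invariant — p. 277 *"since the
measure dφ^{(j)} is rotationally invariant, no account need be made of these rotations"*). [cite: BalabanImbrieJaffe1988, (4.17) p.277] -/
theorem measurePreserving_act (g : GaugeTransf P j U1) :
    MeasurePreserving (act g) ((fieldMeasure P j U1).prod volume) ((fieldMeasure P j U1).prod volume) :=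
  (measurePreserving_gaugeAct g).prod (measurePreserving_twist g)

/-- kernel: the skew product `(g, (u, φ)) ↦ (g, (u^g, gφ))` preserves `dg ⊗ 𝒟u𝒟φ`. [cite: BalabanImbrieJaffe1988, (4.17) p.277] -/
theorem measurePreserving_skew :
    MeasurePreserving (fun p : GaugeTransf P j U1 × (GaugeField P j U1 × HiggsField P j) => (p.1, act p.1 p.2))
      ((transfMeasure P j U1).prod ((fieldMeasure P j U1).prod volume))
      ((transfMeasure P j U1).prod ((fieldMeasure P j U1).prod volume)) :=
  (MeasurePreserving.id _).skew_product (g := fun g z => act g z) measurable_act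
    (Filter.Eventually.of_forall fun g => (measurePreserving_act g).map_eq)

/-- **THE GAUGE AVERAGE of a density** `ρ(u, φ)`: `(gaugeAvg ρ)(u, φ) = ∫dg ρ(u^g, gφ)`, the average of `ρ` over the compact gauge group
`T₁^{(j)} → U(1)` with its normalized Haar measure — the canonical exactly gauge-invariant version of a density that is gauge invariant
almost everywhere (see the module docstring: reading device for (4.17) applied to the a.e.-defined `ρ₁^L`).
[cite: BalabanImbrieJaffe1988, (4.17) p.277] -/
def gaugeAvg (ρ : GaugeField P j U1 → HiggsField P j → ℂ) (U : GaugeField P j U1) (φ : HiggsField P j) : ℂ :=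
  ∫ g, ρ (gaugeAct g U) (twist g φ) ∂transfMeasure P j U1

/-- kernel: the gauge average, uncurried, is the `dg`-integral of `ρ ∘ act`. [cite: BalabanImbrieJaffe1988, (4.17) p.277] -/
theorem uncurry_gaugeAvg (ρ : GaugeField P j U1 → HiggsField P j → ℂ) :
    uncurry (gaugeAvg ρ) = fun z => ∫ g, uncurry ρ (act g z) ∂transfMeasure P j U1 := by
  funext z
  rfl

/-- **The gauge average is EXACTLY jointly gauge invariant**: `(gaugeAvg ρ)(u^h, hφ) = (gaugeAvg ρ)(u, φ)` for every `h` and EVERY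
`(u, φ)` — substitute `g ↦ gh` in the Haar integral (p. 306 of [BalabanImbrieJaffe1985]: *"They generate the gauge group of the integral
𝒯(exp −S)"*).  No hypothesis on `ρ`. [cite: BalabanImbrieJaffe1988, (4.17) p.277] -/
theorem jointInvariant_gaugeAvg (ρ : GaugeField P j U1 → HiggsField P j → ℂ) : JointInvariant (gaugeAvg ρ) := by
  intro h U φ
  unfold gaugeAvg
  simp_rw [T4AvgDerivBound.gaugeAct_gaugeAct, twist_twist]
  exact integral_comp_mul_right h (fun g => ρ (gaugeAct g U) (twist g φ))

/-- kernel: on a density that is already jointly gauge invariant the gauge average is the identity (`∫dg = 1`).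
[cite: BalabanImbrieJaffe1988, (4.17) p.277] -/
theorem gaugeAvg_eq_self {ρ : GaugeField P j U1 → HiggsField P j → ℂ} (hρg : JointInvariant ρ) : gaugeAvg ρ = ρ := by
  funext U φ
  unfold gaugeAvg
  have h : ∀ g : GaugeTransf P j U1, ρ (gaugeAct g U) (twist g φ) = ρ U φ := fun g => hρg g U φ
  simp_rw [h]
  rw [integral_const, probReal_univ, one_smul]

/-- **The gauge average is jointly measurable** (the Haar integral of a jointly measurable integrand, Fubini measurability).
[cite: BalabanImbrieJaffe1988, (4.17) p.277] -/
theorem measurable_gaugeAvg {ρ : GaugeField P j U1 → HiggsField P j → ℂ} (hρm : Measurable (uncurry ρ)) :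
    Measurable (uncurry (gaugeAvg ρ)) := by
  rw [uncurry_gaugeAvg]
  have hF : Measurable fun p : GaugeTransf P j U1 × (GaugeField P j U1 × HiggsField P j) => uncurry ρ (act p.1 p.2) :=
    hρm.comp measurable_act
  exact (hF.stronglyMeasurable.integral_prod_left' (μ := transfMeasure P j U1)).measurable

/-- kernel: `(g, (u, φ)) ↦ ρ(u^g, gφ)` is `dg ⊗ 𝒟u𝒟φ`-integrable for an integrable `ρ` (skew-product invariance).
[cite: BalabanImbrieJaffe1988, (4.17) p.277] -/
theorem integrable_comp_act {ρ : GaugeField P j U1 → HiggsField P j → ℂ} (hρm : Measurable (uncurry ρ))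
    (hρi : Integrable (uncurry ρ) ((fieldMeasure P j U1).prod volume)) :
    Integrable (fun p : GaugeTransf P j U1 × (GaugeField P j U1 × HiggsField P j) => uncurry ρ (act p.1 p.2))
      ((transfMeasure P j U1).prod ((fieldMeasure P j U1).prod volume)) := by
  have h2 : Integrable (fun p : GaugeTransf P j U1 × (GaugeField P j U1 × HiggsField P j) => uncurry ρ p.2)
      ((transfMeasure P j U1).prod ((fieldMeasure P j U1).prod volume)) := hρi.comp_snd _
  have h := (measurePreserving_skew (P := P) (j := j)).integrable_comp (hρm.comp measurable_snd).aestronglyMeasurable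
  exact h.2 h2

/-- **The gauge average of an integrable density is integrable** (Fubini). [cite: BalabanImbrieJaffe1988, (4.17) p.277] -/
theorem integrable_gaugeAvg {ρ : GaugeField P j U1 → HiggsField P j → ℂ} (hρm : Measurable (uncurry ρ))
    (hρi : Integrable (uncurry ρ) ((fieldMeasure P j U1).prod volume)) :
    Integrable (uncurry (gaugeAvg ρ)) ((fieldMeasure P j U1).prod volume) := by
  rw [uncurry_gaugeAvg]
  exact (integrable_comp_act hρm hρi).integral_prod_right

/-- **The gauge average of an almost-everywhere gauge-invariant density is a VERSION of it.**  If for every single gauge transformation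
`g` one has `ρ(u^g, gφ) = ρ(u, φ)` for `𝒟u𝒟φ`-a.e. `(u, φ)` (the null set may depend on `g`), then `gaugeAvg ρ = ρ` almost everywhere:
by Tonelli the exceptional pairs `(g, (u, φ))` form a `dg ⊗ 𝒟u𝒟φ`-null set, so for a.e. `(u, φ)` the integrand `g ↦ ρ(u^g, gφ)` equals
`ρ(u, φ)` for a.e. `g`. [cite: BalabanImbrieJaffe1988, (4.17) p.277] -/
theorem gaugeAvg_ae_eq {ρ : GaugeField P j U1 → HiggsField P j → ℂ} (hρm : Measurable (uncurry ρ))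
    (hae : ∀ g : GaugeTransf P j U1, (fun z => uncurry ρ (act g z)) =ᵐ[(fieldMeasure P j U1).prod volume] uncurry ρ) :
    uncurry (gaugeAvg ρ) =ᵐ[(fieldMeasure P j U1).prod volume] uncurry ρ := by
  -- the defect `‖ρ(u^g, gφ) − ρ(u, φ)‖ₑ` on `((u, φ), g)`-space is measurable …
  have hDm : Measurable fun q : (GaugeField P j U1 × HiggsField P j) × GaugeTransf P j U1 =>
      ‖uncurry ρ (act q.2 q.1) - uncurry ρ q.1‖ₑ := by
    have h1 : Measurable fun q : (GaugeField P j U1 × HiggsField P j) × GaugeTransf P j U1 => uncurry ρ (act q.2 q.1) :=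
      hρm.comp measurable_act_swap
    exact (h1.sub (hρm.comp measurable_fst)).enorm
  -- … and integrates to zero (Tonelli, `(u, φ)` first: every `g`-section vanishes a.e. by hypothesis)
  have hint : ∫⁻ q, ‖uncurry ρ (act q.2 q.1) - uncurry ρ q.1‖ₑ ∂((fieldMeasure P j U1).prod volume).prod (transfMeasure P j U1) = 0 := by
    rw [lintegral_prod_symm' _ hDm]
    have hsec : ∀ g : GaugeTransf P j U1,
        ∫⁻ z, ‖uncurry ρ (act g z) - uncurry ρ z‖ₑ ∂(fieldMeasure P j U1).prod volume = 0 := fun g => by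
      have hz : (fun z => ‖uncurry ρ (act g z) - uncurry ρ z‖ₑ) =ᵐ[(fieldMeasure P j U1).prod volume] 0 := by
        filter_upwards [hae g] with z hz
        simp only [hz, sub_self, enorm_zero, Pi.zero_apply]
      rw [lintegral_congr_ae hz]
      simp only [Pi.zero_apply, lintegral_zero]
    simp_rw [hsec, lintegral_zero]
  -- hence the defect vanishes a.e. on the product, i.e. for a.e. `(u, φ)` it vanishes for a.e. `g`
  have hD0 := Measure.ae_ae_of_ae_prod ((lintegral_eq_zero_iff hDm).1 hint)
  rw [uncurry_gaugeAvg]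
  filter_upwards [hD0] with z hz
  have hz' : (fun g => uncurry ρ (act g z)) =ᵐ[transfMeasure P j U1] fun _ => uncurry ρ z := by
    filter_upwards [hz] with g hg
    have h0 : ‖uncurry ρ (act g z) - uncurry ρ z‖ₑ = 0 := by simpa only [Pi.zero_apply] using hg
    rwa [enorm_eq_zero, sub_eq_zero] at h0
  rw [integral_congr_ae hz', integral_const, probReal_univ, one_smul]

/-! ## §2 (3.11) is insensitive to a change of `ρ₁^L` on a null set; the Radon–Nikodym transform is measurable -/

/-- **(3.11) sees `ρ₁^L` only through `dv dψ`-integrals**: if `ρ₁` satisfies `IsRT311 Qu Qφ a ρ₀ ρ₁` and `ρ₁' = ρ₁` almost everywhere (both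
integrable), then so does `ρ₁'` (companion of r18's `isRT311_unique`: (3.11) determines `ρ₁^L` exactly up to null sets).
[cite: BalabanImbrieJaffe1988, (3.11) p.266] -/
theorem isRT311_congr_ae {a : ℝ} {Qu : GaugeField P j U1 → GaugeField P (j+1) U1}
    {Qφ : GaugeField P j U1 → HiggsField P j → HiggsField P (j+1)} {ρ₀ : GaugeField P j U1 → HiggsField P j → ℂ}
    {ρ₁ ρ₁' : GaugeField P (j+1) U1 → HiggsField P (j+1) → ℂ} (h : IsRT311 Qu Qφ a ρ₀ ρ₁)
    (hi : Integrable (uncurry ρ₁) ((fieldMeasure P (j+1) U1).prod volume))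
    (hi' : Integrable (uncurry ρ₁') ((fieldMeasure P (j+1) U1).prod volume))
    (hae : uncurry ρ₁' =ᵐ[(fieldMeasure P (j+1) U1).prod volume] uncurry ρ₁) :
    IsRT311 Qu Qφ a ρ₀ ρ₁' := by
  intro t ht hb
  obtain ⟨C, hC⟩ := hb
  have key : ∀ {ρ : GaugeField P (j+1) U1 → HiggsField P (j+1) → ℂ},
      Integrable (uncurry ρ) ((fieldMeasure P (j+1) U1).prod volume) →
      ∫ v, ∫ ψ, ρ v ψ * t (v, ψ) ∂volume ∂fieldMeasure P (j+1) U1 =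
        ∫ z, uncurry ρ z * t z ∂(fieldMeasure P (j+1) U1).prod volume := by
    intro ρ hρ
    have hρt : Integrable (fun z => uncurry ρ z * t z) ((fieldMeasure P (j+1) U1).prod volume) :=
      hρ.mul_bdd ht.aestronglyMeasurable (Filter.Eventually.of_forall hC)
    exact (integral_prod _ hρt).symm
  have hae' : (fun z => uncurry ρ₁' z * t z) =ᵐ[(fieldMeasure P (j+1) U1).prod volume] fun z => uncurry ρ₁ z * t z := by
    filter_upwards [hae] with z hz
    rw [hz]
  rw [key hi', integral_congr_ae hae', ← key hi]
  exact h t ht ⟨C, hC⟩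

/-- kernel: the Radon–Nikodym transform `𝒯ρ` of [BalabanImbrieJaffe1985] (3.3) (`BIJ85RT33.RTData.rt`) is jointly measurable in
`(v, ψ)` (Radon–Nikodym derivatives are measurable). [cite: BalabanImbrieJaffe1985, (3.3) p.306] -/
theorem measurable_rt (D : BIJ85RT33.RTData P j) (A : BIJ85RT33.ApproxDelta P j) (ρ : GaugeField P j U1 → HiggsField P j → ℂ) :
    Measurable (uncurry (D.rt A ρ)) := by
  have hrn : ∀ h : GaugeField P j U1 × HiggsField P (j+1) → ℝ, Measurable (D.rnReal h) := fun h => by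
    unfold BIJ85RT33.RTData.rnReal
    exact (Measure.measurable_rnDeriv _ _).ennreal_toReal.sub (Measure.measurable_rnDeriv _ _).ennreal_toReal
  have e : uncurry (D.rt A ρ) = fun q : GaugeField P (j+1) U1 × HiggsField P (j+1) =>
      (D.rnReal (fun p => (D.smearAx A ρ p).re) q : ℂ) + (D.rnReal (fun p => (D.smearAx A ρ p).im) q : ℂ) * I := by
    funext q
    rfl
  rw [e]
  exact (measurable_ofReal.comp (hrn _)).add ((measurable_ofReal.comp (hrn _)).mul_const I)

end

end Literature.MathematicalPhysics.QuantumFieldTheory.BalabanImbrieJaffe1984to88.BIJ88GaugeAverage
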